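import Summits.BirchSwinnertonDyer.BirchSwinnertonDyer.Theorems.KimAtThreeTwoExponentTower
import Summits.BirchSwinnertonDyer.BirchSwinnertonDyer.Theorems.KimAtThreeShallowEqDeepSplitGlueNoStub
import Summits.BirchSwinnertonDyer.BirchSwinnertonDyer.Theorems.KimAtThreeShallowEqDeepOffStratumSockets
import Summits.BirchSwinnertonDyer.BirchSwinnertonDyer.Theorems.KimAtThreeDeepLowerKatoStratumOfFacts
import HarnessLib

/-!
# Route `KimAtThreeKolyvagin` (rung W2), crux `ShallowEqDeepOffKatoStratum` (item 19599): the registered stub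
# `stub_additiveDefect` ⟸ {PORT₂-SHARED on the additive-defect rows, 19562's `stub_additiveDefect`} + PUB

Cell `bsd-addord`, seat `bsd-addord-w2-acc6` (PROGRAMME PART 1b, plan g16 ACCEL-LIST (6) / plan g17 BRIEF/ACC
2026-08-26T14:36:01Z «additive rows: 19599-row ⟸ 19562-row + … through §1 socket, with the additive defect
bookkeeping shared with acc1/acc3»); `--supports` 19599 (helper; the item OWNER assembles via
`Cruxes.ShallowEqDeepOffKatoStratum.Birth.ShallowEqDeepOffKatoStratum_of`).  Theorems only (no definition, no named
fact, no `sorry`); nothing asserted, nothing booked; crux 19599 stays OPEN.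

WHAT.  `stub_additiveDefect_of_portTwoExp_of_upperRow`: its TYPE is the registered stub `stub_additiveDefect` of
`Cruxes/ShallowEqDeepOffKatoStratum/Lines/birth.lean` VERBATIM, GRANTED — displayed, never hidden — (i) the four
PUBLISHED facts [S24] Thm. 4.4 (1)(2), GZK, Poitou–Tate BY NAME; (ii) `hPort₂` = PORT₂-SHARED: the two-exponent
shared-generator Kato–Kurihara closure `KatoKuriharaPortThreeAtWith₂TwoExp W 0 e v₃ η P` (SOME `e`; in print
`e = v₃(c₃) + v₃(c_P)`) on every additive-defect row — crux 19560's `KatoKuriharaPortThreeShared` shape with the defect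
(`3 ∣ c₃ ∨ 3 ∣ c_P`) in place of its negation (FLAG `K22-Thm3.13-PORT@3`; the residual OBJECT of these rows, typed in
`KimAtThreeKolyvaginDefs`; NOT in print at `3`); (iii) `hUpper` = the registered stub `stub_additiveDefect` of the UPPER
twin crux 19562 (`Cruxes/DeepUpperAtThreeOffKatoStratum/Lines/birth.lean`; seat acc1, owner w2-c5) VERBATIM.  Road:
w2-c4 g5's socket `shallowEqDeep_conclusion_of_upperRow_of_le_add_partialInfty` (p449980 §1) fed by
`KimAtThreeTwoExponentTower.kuriharaPartial_zero_le_sha_add_partialInfty_of_portTwoExp` (`a ≤ s + ∂^{(∞)}` from the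
port: the defect exponent `e` cancels, `KimAtThreeTwoExponentAssembly`).  The row version
`shallowEqDeepOff_row_additive_of_portTwoExp_of_upperRow` displays the 19562-row conclusion `hU` instead of the stub.
`katoKuriharaWitnessAt_smul_of_witnessAtTwoExp`: PORT₂'s witnesses scaled by `3^e` ARE n1011's one-exponent witnesses (acc1's
currency for the deepUpper road of crux 19562) — one object serves both roads.
SEQUEL (append to this file once acc1's `KimAtThreeDeepUpperOffStratumPortE` has an olean on the farm): the UPPER
twin is itself a consequence of PORT₂ through acc1's `deepUpper_conclusion_of_port_e` (single-depth free-exponent port, fed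
at exponent `0` by PORT₂'s scaled witnesses, `katoKuriharaWitnessAt_smul_of_witnessAtTwoExp` below), so the registered
19599 stub follows from PORT₂-SHARED and the four PUBLISHED facts ALONE.
WHAT IS NOT HERE: PORT₂ itself (its discharger-to-be is ★ PK-6₂'s `KatoKuriharaPortThreeOfZetaBody` road with the
IV/IV* local lattice `exp*_ω(H¹(ℚ₃,T)) = 3^{v₃(c₃)−t}ℤ₃·ω`, kim3 memo Lemma L/L′); the 19562 defect stub (acc1).
References: [Kim2022StructureSelmer] Thm. 1.9 (6), Thm. 3.13, §3.2.3, Rem. 3.7, Lemma 3.9; [Kim2025RefinedTNC] Thm 1.1,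
Thm 1.2, §8.1.2; [Sakamoto2024] Thm. 4.4; [MazurRubin2004] Thm. 3.2.4, 4.4.1, 5.2.12, App. A (33);
[Kato2004Asterisque] Thm. 12.5 (1); [MilneADT2006] I Thm. 4.10; cell memo
`run/shared/lean/pub/bsd-addord/kim3/KIM3-PROOF.md` §4.4, Lemma L/L′, §16 (Cor C-t).
-/

set_option autoImplicit false
-- the Theorems namespace of a single-conjunct summit repeats the summit name by design (D-0017)
set_option linter.dupNamespace false

noncomputable section

open scoped Classical NumberField ContRepresentation
open Function Field NumberField IsDedekindDomain IsDedekindDomain.HeightOneSpectrum WeierstrassCurve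
  CongruenceSubgroup
  Literature.NumberTheory.EllipticCurves Literature.NumberTheory.EllipticCurves.ModularForms
  Literature.NumberTheory.EllipticCurves.Rank1Residual
  Literature.NumberTheory.GaloisRepresentations
  Literature.NumberTheory.GaloisRepresentations.DiscreteGaloisModule Literature.NumberTheory.GaloisCohomology
  Rat.HeightOneSpectrum
  Summit.BirchSwinnertonDyer.Rank1Residual.GaloisImage
  Summit.BirchSwinnertonDyer.Rank1Residual.GaloisImage.Assembly
  Summit.BirchSwinnertonDyer.Rank1Residual.X4

namespace Summit.BirchSwinnertonDyer.BirchSwinnertonDyer.Theorems.KimAtThreeShallowEqDeepOffStratumAdditiveDefect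

open Summit.BirchSwinnertonDyer.BirchSwinnertonDyer.Theorems.KimAtThreeKolyvaginDefs
  Summit.BirchSwinnertonDyer.BirchSwinnertonDyer.Theorems.KimAtThreeTwoExponentTower
  Summit.BirchSwinnertonDyer.BirchSwinnertonDyer.Theorems.KimAtThreeShallowEqDeepOffStratumSockets
  Summit.BirchSwinnertonDyer.BirchSwinnertonDyer.Theorems.KimAtThreeDeepLowerKatoStratumOfFacts
  Summit.BirchSwinnertonDyer.BirchSwinnertonDyer.Theorems.KimAtThreeShallowEqDeepSplitGlueNoStub
  Summit.BirchSwinnertonDyer.BirchSwinnertonDyer.Theorems.KimAtThreeKolyvaginUnitLevelOneRungs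

/-- **PORT₂'s witnesses SCALE to n1011's one-exponent witnesses** (acc1's currency, seat bsd-addord-w2-acc1:
«scaling Kato's families by `3^e` turns the two-exponent law into `KatoKuriharaWitnessAt` with a free exponent»):
if `(κ, Λ, κ′)` satisfy the two-exponent clauses with exponents `(e, t)`, then `(3^e • κ, Λ, 3^e • κ′)` satisfy
n1011's `KatoKuriharaWitnessAt W k t D v₃ P` — (0) and (I4) are stable under `ℕ`-scaling (the Kolyvagin systems form
a subgroup; the unitriangular bridge scales), (Λ) is untouched, and `Λ(loc (3^e•κ)_d) = 3^e · Λ(loc κ_d) = u·3^t·δ̃`.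
So ONE object (PORT₂) serves the certificate road (this file) AND the deepUpper road of crux 19562.
[cite: Kim2022StructureSelmer, Thm. 3.13 (arXiv p. 17)] [cite: MazurRubin2004, Thm. 3.2.4 and App. A (33)] -/
theorem katoKuriharaWitnessAt_smul_of_witnessAtTwoExp
    (W : WeierstrassCurve ℚ) [W.IsElliptic] [W.IsGloballyMinimal] (k t e : ℕ)
    (D : KolyvaginDatum (W.torsionGaloisModule (((3 : ℕ) : ℤ) ^ k * ((3 : ℕ) : ℤ))))
    (v₃ : HeightOneSpectrum (𝓞 ℚ)) {N : ℕ} [NeZero N] (P : ModularParametrizationData W N)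
    (κ : Finset (HeightOneSpectrum (𝓞 ℚ)) →
      galoisCohomology (W.torsionGaloisModule (((3 : ℕ) : ℤ) ^ k * ((3 : ℕ) : ℤ))) 1)
    (Λ : galoisCohomology ((W.torsionGaloisModule (((3 : ℕ) : ℤ) ^ k * ((3 : ℕ) : ℤ))).toLocal
      (Sum.inr v₃)) 1 →+ ZMod (3 ^ (k + 1)))
    (κ' : Finset (HeightOneSpectrum (𝓞 ℚ)) →
      galoisCohomology (W.torsionGaloisModule (((3 : ℕ) : ℤ) ^ k * ((3 : ℕ) : ℤ))) 1)
    (hW : KatoKuriharaWitnessAtTwoExp W k t e D v₃ P κ Λ κ') :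
    KatoKuriharaWitnessAt W k t D v₃ P ((3 ^ e) • κ) Λ ((3 ^ e) • κ') := by
  obtain ⟨h0, ⟨hKS, hbr⟩, hon, hker, hdict⟩ := hW
  refine ⟨fun d hd => ?_, ⟨?_, fun d hd => ?_⟩, hon, hker, fun d hd => ?_⟩
  · -- (0)
    simpa only [Pi.smul_apply] using AddSubgroup.nsmul_mem _ (h0 d hd) (3 ^ e)
  · -- (I4): the Kolyvagin systems form a subgroup
    exact AddSubgroup.nsmul_mem _ hKS (3 ^ e)
  · -- the unitriangular bridge scales
    have h := hbr d hd
    have hsub : AddSubgroup.closure {x | ∃ c, c ⊂ d ∧ x = κ c} ≤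
        (AddSubgroup.closure {x | ∃ c, c ⊂ d ∧ x = ((3 ^ e) • κ) c}).comap
          (nsmulAddMonoidHom (α := galoisCohomology
            (W.torsionGaloisModule (((3 : ℕ) : ℤ) ^ k * ((3 : ℕ) : ℤ))) 1) (3 ^ e)) := by
      rw [AddSubgroup.closure_le]
      rintro x ⟨c, hc, rfl⟩
      exact AddSubgroup.subset_closure ⟨c, hc, by simp [Pi.smul_apply]⟩
    have h' := hsub h
    rw [AddSubgroup.mem_comap] at h'
    simpa only [Pi.smul_apply, nsmulAddMonoidHom_apply, smul_sub] using h'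
  · -- (DICT3): `Λ(loc (3^e•κ)_d) = 3^e · Λ(loc κ_d)`
    obtain ⟨u, ψ, hψ, hL⟩ := hdict d hd
    refine ⟨u, ψ, hψ, ?_⟩
    rw [Pi.smul_apply, map_nsmul, map_nsmul, nsmul_eq_mul]
    push_cast at hL ⊢
    exact hL

/-- **Crux 19599 at ONE additive-defect row from the two-exponent port and the UPPER twin at the row.**  Row:
tower onto, ADDITIVE at `3` (Kodaira IV/IV* or `3 ∣ c_D` — or none: the defect is not even needed), `E(ℚ₃)[3] = 0`,
datum `D` at the conductor, `ord(δ̃) = 0`; GRANTED [S24] (1)(2), GZK, Poitou–Tate (all PUB, by name), ONE port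
`KatoKuriharaPortThreeAtWith₂TwoExp W 0 e v₃ η D` and the row conclusion `hU` of crux 19562
(`DeepUpperAtThreeOffKatoStratum`: `∂^{(∞)}_deep = d`, `ord₃ #Ш(3) + d ≤ ∂⁽⁰⁾`): **`∂^{(∞)}_deep(δ̃) ≤ ∂^{(∞)}(δ̃)`**
— w2-c4 g5's socket `shallowEqDeep_conclusion_of_upperRow_of_le_add_partialInfty` fed by
`kuriharaPartial_zero_le_sha_add_partialInfty_of_portTwoExp`. [cite: Kim2025RefinedTNC, Thm 1.1, Thm 1.2 and §8.1.2]
[cite: Kim2022StructureSelmer, Thm. 1.9 (6), §1.5.1] [cite: MazurRubin2004, Def. 5.2.11 and Thm. 5.2.12]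
[cite: Sakamoto2024, Thm. 4.4 (p. 926)] [cite: MilneADT2006, Ch. I, Thm. 4.10] -/
theorem shallowEqDeepOff_row_additive_of_portTwoExp_of_upperRow
    (hS24 : Sakamoto2024.kolyvaginSystems_freeRankOne_zmod_three_pow)
    (hS24₂ : Sakamoto2024.kolyvaginSystems_idealOfBasis_eq_fittingIdeal_zmod_three_pow)
    (hGZK : rank_eq_analyticRank_of_analyticRank_le_one)
    (hPT : poitouTate_selmerStructure_duality ℚ)
    (W : WeierstrassCurve ℚ) [W.IsElliptic] [W.IsGloballyMinimal]
    (hadd : haveI : Fact (Nat.Prime 3) := ⟨Nat.prime_three⟩; Addv W 3)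
    (htower : ∀ m : ℕ, W.HasSurjectiveModNGaloisRep (3 ^ m : ℕ))
    (ht0 : Nat.card {Q : (W.baseChange ℚ_[3]).toAffine.Point // (3 : ℕ) • Q = 0} = 1)
    {N : ℕ} [NeZero N] (hN : N = W.conductorNorm ℤ) (D : ModularParametrizationData W N) (e : ℕ)
    (v₃ : HeightOneSpectrum (𝓞 ℚ)) (hv₃ : ((3 : ℕ) : 𝓞 ℚ) ∈ v₃.asIdeal)
    (η : (q : HeightOneSpectrum (𝓞 ℚ)) → (ZMod (Ideal.absNorm q.asIdeal))ˣ)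
    (hη : ∀ q : HeightOneSpectrum (𝓞 ℚ), Subgroup.zpowers (η q) = ⊤)
    (hPort : KatoKuriharaPortThreeAtWith₂TwoExp W 0 e v₃ η D)
    (hord : kuriharaVanishingOrder W 3 D.f = 0)
    (hU : ∃ d : ℕ, kuriharaPartialDeepInfty W 3 D.f = d ∧
      ((padicValNat 3 (Nat.card (AddCommGroup.primaryComponent W.sha 3)) + d : ℕ) : ℕ∞) ≤
        kuriharaPartial W 3 D.f 0) :
    kuriharaPartialDeepInfty W 3 D.f ≤ kuriharaPartialInfty W 3 D.f := by
  haveI : Fact (Nat.Prime 3) := ⟨Nat.prime_three⟩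
  obtain ⟨inv, hperf, hsum, -, hcompl⟩ := hPT 3
  obtain ⟨inv', hperf', hsum', hcompl', hinj'⟩ := exists_localInvariants_three_pow_of_poitouTate hPT
  exact shallowEqDeep_conclusion_of_upperRow_of_le_add_partialInfty W 3 D.f hU
    (kuriharaPartial_zero_le_sha_add_partialInfty_of_portTwoExp hS24 hS24₂ hGZK W hadd htower ht0 hN D e inv
      hperf hsum hcompl inv' hperf' hsum' hcompl' hinj' v₃ hv₃ η hη hPort hord)

/-- **The registered stub `stub_additiveDefect` of crux 19599 (`ShallowEqDeepOffKatoStratum`,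
`Cruxes/ShallowEqDeepOffKatoStratum/Lines/birth.lean`) ⟸ THREE displayed named hypotheses** (besides the four
PUBLISHED facts [S24] (1)(2), GZK, Poitou–Tate, by name):
* `hPort₂` — PORT₂-SHARED: the two-exponent shared-generator Kato–Kurihara closure
  `KatoKuriharaPortThreeAtWith₂TwoExp W 0 e v₃ η P` (SOME `e`; in print `e = v₃(c₃) + v₃(c_P)`) for every
  tower-surjective `W` additive at `3` with `E(ℚ₃)[3] = 0`, every `v₃ ∣ 3` and generator family `η`, and every
  lattice-optimal datum `P` at the conductor ON THE ADDITIVE-DEFECT ROWS (`3 ∣ c₃ ∨ 3 ∣ c_P`) — crux 19560's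
  `KatoKuriharaPortThreeShared` shape with the defect instead of its negation (FLAG `K22-Thm3.13-PORT@3`, the
  residual OBJECT of these rows, typed in `KimAtThreeKolyvaginDefs`);
* `hUpper` — the registered stub `stub_additiveDefect` of the UPPER twin crux 19562
  (`Cruxes/DeepUpperAtThreeOffKatoStratum/Lines/birth.lean`, seat acc1 / owner w2-c5) VERBATIM.
The type of the conclusion is the 19599 stub VERBATIM: for the OWNER's `ShallowEqDeepOffKatoStratum_of`.  The
additive defect (`3 ∣ c₃`: Kodaira IV/IV*; `3 ∣ c_{D₀}`: `9 ∣ N`, empty below `N ≤ 300000` by w2-c4 g5's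
`KimAtThreeShallowEqDeepOffStratumManinDefect`) moves NEITHER side of shallow = deep: it is one exponent `e` on the
`Λ`-side of the dictionary, and `e` cancels (`KimAtThreeTwoExponentAssembly`).
[cite: Kim2025RefinedTNC, Thm 1.1, Thm 1.2 and §8.1.2] [cite: Kim2022StructureSelmer, Thm. 1.9 (6) and Thm. 3.13]
[cite: MazurRubin2004, Thm. 5.2.12] [cite: Sakamoto2024, Thm. 4.4 (p. 926)] [cite: MilneADT2006, Ch. I, Thm. 4.10] -/
theorem stub_additiveDefect_of_portTwoExp_of_upperRow
    (hS24 : Sakamoto2024.kolyvaginSystems_freeRankOne_zmod_three_pow)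
    (hS24₂ : Sakamoto2024.kolyvaginSystems_idealOfBasis_eq_fittingIdeal_zmod_three_pow)
    (hGZK : rank_eq_analyticRank_of_analyticRank_le_one)
    (hPT : poitouTate_selmerStructure_duality ℚ)
    (hPort₂ : ∀ (W : WeierstrassCurve ℚ) [W.IsElliptic] [W.IsGloballyMinimal],
      (∀ m : ℕ, W.HasSurjectiveModNGaloisRep (3 ^ m : ℕ)) →
      (haveI : Fact (Nat.Prime 3) := ⟨Nat.prime_three⟩; Addv W 3) →
      Nat.card {Q : (W.baseChange ℚ_[3]).toAffine.Point // (3 : ℕ) • Q = 0} = 1 →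
      ∀ (v₃ : HeightOneSpectrum (𝓞 ℚ)), ((3 : ℕ) : 𝓞 ℚ) ∈ v₃.asIdeal →
      ∀ (η : (q : HeightOneSpectrum (𝓞 ℚ)) → (ZMod (Ideal.absNorm q.asIdeal))ˣ),
        (∀ q, Subgroup.zpowers (η q) = ⊤) →
      ∀ {N : ℕ} [NeZero N] (P : ModularParametrizationData W N), N = W.conductorNorm ℤ →
        (∀ z ∈ P.L.lattice, ∃ w ∈ periodLattice P.f, z = P.c * w) →
        (3 ∣ (W.baseChange ℚ_[3]).localTamagawaNumber ℤ_[3] ∨ (3 : ℤ) ∣ P.maninConstant) →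
          ∃ e : ℕ, KatoKuriharaPortThreeAtWith₂TwoExp W 0 e v₃ η P)
    (hUpper : ∀ (W₀ : WeierstrassCurve ℚ) [W₀.IsElliptic] [W₀.IsGloballyMinimal],
      (∀ n : ℕ, W₀.HasSurjectiveModNGaloisRep (3 ^ n : ℕ)) → Finite W₀.sha →
      ∀ {N : ℕ} [NeZero N], N = W₀.conductorNorm ℤ →
      ∀ (D₀ : Literature.NumberTheory.EllipticCurves.ModularForms.ModularParametrizationData W₀ N),
        (∀ z ∈ D₀.L.lattice, ∃ w ∈ Literature.NumberTheory.EllipticCurves.ModularForms.periodLattice D₀.f, z = D₀.c * w) →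
        (∀ (W₂ : WeierstrassCurve ℚ) [W₂.IsElliptic]
          (D₂ : Literature.NumberTheory.EllipticCurves.ModularForms.ModularParametrizationData W₂ N),
          D₂.f = D₀.f → D₀.modularDegree ≤ D₂.modularDegree) →
        (∀ r : ℚ, Literature.NumberTheory.EllipticCurves.ratPlusSymbol D₀.f r ≠ 0 →
          0 ≤ padicValRat 3 (Literature.NumberTheory.EllipticCurves.ratPlusSymbol D₀.f r)) →
        Literature.NumberTheory.EllipticCurves.kuriharaVanishingOrder W₀ 3 D₀.f = 0 →
        (haveI : Fact (Nat.Prime 3) := ⟨Nat.prime_three⟩;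
            Literature.NumberTheory.EllipticCurves.Rank1Residual.Addv W₀ 3) →
        (3 ∣ (W₀.baseChange ℚ_[3]).localTamagawaNumber ℤ_[3] ∨
          Nat.card {Q : (W₀.baseChange ℚ_[3]).toAffine.Point // (3 : ℕ) • Q = 0} ≠ 1 ∨
          (3 : ℤ) ∣ D₀.maninConstant) →
        ∃ d : ℕ, Literature.NumberTheory.EllipticCurves.kuriharaPartialDeepInfty W₀ 3 D₀.f = d ∧
          ((padicValNat 3 (Nat.card (AddCommGroup.primaryComponent W₀.sha 3)) + d : ℕ) : ℕ∞) ≤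
            Literature.NumberTheory.EllipticCurves.kuriharaPartial W₀ 3 D₀.f 0) :
    ∀ (W₀ : WeierstrassCurve ℚ) [W₀.IsElliptic] [W₀.IsGloballyMinimal],
      (∀ n : ℕ, W₀.HasSurjectiveModNGaloisRep (3 ^ n : ℕ)) →
      Nat.card {Q : (W₀.baseChange ℚ_[3]).toAffine.Point // (3 : ℕ) • Q = 0} = 1 → Finite W₀.sha →
      ∀ {N : ℕ} [NeZero N], N = W₀.conductorNorm ℤ →
      ∀ (D₀ : Literature.NumberTheory.EllipticCurves.ModularForms.ModularParametrizationData W₀ N),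
        (∀ z ∈ D₀.L.lattice, ∃ w ∈ Literature.NumberTheory.EllipticCurves.ModularForms.periodLattice D₀.f, z = D₀.c * w) →
        (∀ (W₂ : WeierstrassCurve ℚ) [W₂.IsElliptic]
          (D₂ : Literature.NumberTheory.EllipticCurves.ModularForms.ModularParametrizationData W₂ N),
          D₂.f = D₀.f → D₀.modularDegree ≤ D₂.modularDegree) →
        (∀ r : ℚ, Literature.NumberTheory.EllipticCurves.ratPlusSymbol D₀.f r ≠ 0 →
          0 ≤ padicValRat 3 (Literature.NumberTheory.EllipticCurves.ratPlusSymbol D₀.f r)) →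
        Literature.NumberTheory.EllipticCurves.kuriharaVanishingOrder W₀ 3 D₀.f = 0 →
        (haveI : Fact (Nat.Prime 3) := ⟨Nat.prime_three⟩;
            Literature.NumberTheory.EllipticCurves.Rank1Residual.Addv W₀ 3) →
        (3 ∣ (W₀.baseChange ℚ_[3]).localTamagawaNumber ℤ_[3] ∨ (3 : ℤ) ∣ D₀.maninConstant) →
        Literature.NumberTheory.EllipticCurves.kuriharaPartialDeepInfty W₀ 3 D₀.f ≤
          Literature.NumberTheory.EllipticCurves.kuriharaPartialInfty W₀ 3 D₀.f := by
  intro W₀ _ _ htow ht hfin N _ hN D₀ hopt hdeg hint hord hA hdef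
  haveI : Fact (Nat.Prime 3) := ⟨Nat.prime_three⟩
  obtain ⟨v₃, η, hv₃, hη⟩ := exists_place_three_and_generators
  obtain ⟨e, hPort⟩ := hPort₂ W₀ htow hA ht v₃ hv₃ η hη D₀ hN hopt hdef
  exact shallowEqDeepOff_row_additive_of_portTwoExp_of_upperRow hS24 hS24₂ hGZK hPT W₀ hA htow ht hN D₀ e v₃
    hv₃ η hη hPort hord
    (hUpper W₀ htow hfin hN D₀ hopt hdeg hint hord hA (hdef.elim Or.inl fun h => Or.inr (Or.inr h)))

end Summit.BirchSwinnertonDyer.BirchSwinnertonDyer.Theorems.KimAtThreeShallowEqDeepOffStratumAdditiveDefect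

end
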